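import Summits.CriticalPhenomena.PercolationContinuityZ3.Theorems.PercNearOneGluingNoHeavyPcintSignedConfigAlgebra
import HarnessLib

/-!
# CriticalPhenomena/PercolationContinuityZ3 — Theorems/PercNearOneGluingNoHeavyPcintSignedConfigEven.lean: EVENIZATION `x ↦ X²` — the size variable of the forest counts versus the chord variable of the closed form

Lane prim-pcint, STRUCTURE rule «numerics ⇒ structure ⇒ conjecture» (prim-pcint-2 GEN 22); sequel of …PcintSignedConfigAlgebra.  The counting
series of the forest decomposition (…PcintSignedConfigSeries) are in the SIZE variable `X` (one per point, so two per chord), the closed form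
`oneDefectGF` in the CHORD variable `x`.  The ring map `ev : φ(x) ↦ φ(X²)` (`evHom`) links them: `HS j = ev (Hx j)` (`HS_eq_ev`, via
`#goodSet (Fin 2k) = a(k)`), `UX := ev Ux` with `UX · (1 − HS 1) = 1` (`UX_mul`), `HS 0 = X²·UX`, `ev Apx = UX²(1 + HS 2)` (`ev_Apx`), and
`coeff (2m) (ev closedFormX) = oneDefectGF m` (`coeff_ev_closedFormX`).

HONEST FRAMING: algebra of formal power series only.  No `sorry`; standard axioms.  Written by prim-pcint-2 gen 22 (prover-prim-pcint-2-g22-0), 2026-08-27.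
-/

open PowerSeries

namespace Summit.CriticalPhenomena.PercolationContinuityZ3.Theorems.Pcint.ChordDiag

open Summit.CriticalPhenomena.PercolationContinuityZ3.Theorems.Pcint.MemoryTail (connChord connChord_values oneDefectGF)

/-! ### Evenization -/

/-- `ev φ = φ(X²)`: the coefficient of `X^{2m}` is the coefficient of `x^m`, odd coefficients vanish. [folklore] -/
noncomputable def ev (φ : ℤ⟦X⟧) : ℤ⟦X⟧ := PowerSeries.mk fun n => if Even n then coeff (n / 2) φ else 0

/-- Coefficients of `ev`. [folklore] -/
theorem coeff_ev (φ : ℤ⟦X⟧) (n : ℕ) : coeff n (ev φ) = if Even n then coeff (n / 2) φ else 0 := by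
  simp [ev]

/-- Even coefficients of `ev`. [folklore] -/
theorem coeff_ev_two_mul (φ : ℤ⟦X⟧) (m : ℕ) : coeff (2 * m) (ev φ) = coeff m φ := by
  rw [coeff_ev, if_pos (even_two_mul m), Nat.mul_div_cancel_left m (by norm_num)]

/-- Odd coefficients of `ev`. [folklore] -/
theorem coeff_ev_two_mul_add_one (φ : ℤ⟦X⟧) (m : ℕ) : coeff (2 * m + 1) (ev φ) = 0 := by
  rw [coeff_ev, if_neg (Nat.not_even_two_mul_add_one m)]

/-- `ev` is additive. [folklore] -/
theorem ev_add (φ ψ : ℤ⟦X⟧) : ev (φ + ψ) = ev φ + ev ψ := by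
  ext n; rw [map_add, coeff_ev, coeff_ev, coeff_ev]; split_ifs <;> simp

/-- `ev 1 = 1`. [folklore] -/
theorem ev_one : ev 1 = 1 := by
  ext n
  rw [coeff_ev, coeff_one, coeff_one]
  by_cases h : n = 0
  · subst h; simp
  · split_ifs with h1 h2
    · exfalso; obtain ⟨k, rfl⟩ := h1; omega
    · rfl
    · rfl

/-- **`ev` is multiplicative.** [folklore] -/
theorem ev_mul (φ ψ : ℤ⟦X⟧) : ev (φ * ψ) = ev φ * ev ψ := by
  ext n
  rw [PowerSeries.coeff_mul n (ev φ) (ev ψ), coeff_ev]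
  obtain ⟨m, rfl | rfl⟩ := Nat.even_or_odd' n
  · rw [if_pos (even_two_mul m), Nat.mul_div_cancel_left m (by norm_num), PowerSeries.coeff_mul m φ ψ]
    -- the terms with `p.1` odd vanish; the even ones come from `antidiagonal m` doubled
    rw [← Finset.sum_filter_add_sum_filter_not (Finset.antidiagonal (2 * m)) (fun p => Even p.1)]
    rw [Finset.sum_eq_zero (s := (Finset.antidiagonal (2 * m)).filter fun p => ¬Even p.1) fun p hp => by
      rw [Finset.mem_filter] at hp; rw [coeff_ev, if_neg hp.2, zero_mul], add_zero]
    have hmap : (Finset.antidiagonal (2 * m)).filter (fun p => Even p.1) =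
        (Finset.antidiagonal m).map ⟨fun q => (2 * q.1, 2 * q.2), fun q q' h => by
          simp only [Prod.mk.injEq] at h; exact Prod.ext (by omega) (by omega)⟩ := by
      ext ⟨a, b⟩
      simp only [Finset.mem_filter, Finset.mem_antidiagonal, Finset.mem_map, Function.Embedding.coeFn_mk, Prod.mk.injEq,
        Prod.exists]
      constructor
      · rintro ⟨hab, ⟨a', rfl⟩⟩
        exact ⟨a', b / 2, by omega, by omega, by omega⟩
      · rintro ⟨a', b', hab', rfl, rfl⟩
        exact ⟨by omega, ⟨a', by ring⟩⟩
    rw [hmap, Finset.sum_map]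
    refine Finset.sum_congr rfl fun q _ => ?_
    simp only [Function.Embedding.coeFn_mk]
    rw [coeff_ev_two_mul, coeff_ev_two_mul]
  · rw [if_neg (Nat.not_even_two_mul_add_one m)]
    refine (Finset.sum_eq_zero fun p hp => ?_).symm
    rw [Finset.mem_antidiagonal] at hp
    rw [coeff_ev, coeff_ev]
    by_cases h1 : Even p.1
    · have h2 : ¬Even p.2 := fun h2 => by
        obtain ⟨a, ha⟩ := h1; obtain ⟨b, hb⟩ := h2; omega
      rw [if_neg h2, mul_zero]
    · rw [if_neg h1, zero_mul]

/-- `ev` as a ring homomorphism. [folklore] -/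
noncomputable def evHom : ℤ⟦X⟧ →+* ℤ⟦X⟧ where
  toFun := ev
  map_one' := ev_one
  map_mul' := ev_mul
  map_zero' := by ext n; rw [coeff_ev]; simp
  map_add' := ev_add

/-- `evHom` is `ev`. [folklore] -/
@[simp] theorem evHom_apply (φ : ℤ⟦X⟧) : evHom φ = ev φ := rfl

/-! ### The core series are evenizations -/

/-- `#goodSet (Fin 2k) = a(k)` and `#goodSet (Fin (2k+1)) = 0`, as `gsz`. [folklore] -/
theorem gsz_even {k : ℕ} (hk : 1 ≤ k) : gsz (2 * k) = connChord k := by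
  unfold gsz; rw [card_goodSet_fin k hk]

/-- Odd sizes carry no chord diagram. [folklore] -/
theorem gsz_odd (k : ℕ) : gsz (2 * k + 1) = 0 := by
  unfold gsz; rw [card_goodSet_fin_odd k]; simp

/-- **`HS j = ev (Hx j)`.** [folklore] -/
theorem HS_eq_ev (j : ℕ) : HS j = ev (Hx j) := by
  ext n
  rw [coeff_HS, coeff_ev]
  obtain ⟨k, rfl | rfl⟩ := Nat.even_or_odd' n
  · rw [if_pos (even_two_mul k), Nat.mul_div_cancel_left k (by norm_num), coeff_Hx]
    rcases Nat.eq_zero_or_pos k with hk | hk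
    · subst hk; simp [connChord_zero]
    · rw [if_pos (by omega), gsz_even hk, mul_comm]
  · rw [if_neg (Nat.not_even_two_mul_add_one k), gsz_odd]
    simp

/-- `U(X²)`, the chain series in the size variable. [folklore] -/
noncomputable def UX : ℤ⟦X⟧ := ev Ux

/-- **`UX · (1 − HS 1) = 1`.** [folklore] -/
theorem UX_mul : UX * (1 - HS 1) = 1 := by
  have := congrArg evHom Ux_mul
  rw [map_mul, map_sub, map_one] at this
  unfold UX
  rw [HS_eq_ev]
  exact this

/-- **`HS 0 = X² · UX`** (`Σ a(k)X^{2k} = X²·U(X²)`). [folklore] -/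
theorem HS_zero_eq : HS 0 = X ^ 2 * UX := by
  ext n
  rw [coeff_HS, Nat.choose_zero_right, Nat.cast_one, mul_one, PowerSeries.coeff_X_pow_mul']
  unfold UX
  obtain ⟨k, rfl | rfl⟩ := Nat.even_or_odd' n
  · rcases Nat.eq_zero_or_pos k with hk | hk
    · subst hk; simp
    · rw [if_pos (by omega), if_pos (by omega), gsz_even hk, show 2 * k - 2 = 2 * (k - 1) by omega, coeff_ev_two_mul, coeff_Ux,
        show k - 1 + 1 = k by omega]
  · rw [gsz_odd]
    split_ifs with h
    · rw [show 2 * k + 1 - 2 = 2 * (k - 1) + 1 by omega, coeff_ev_two_mul_add_one]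
    · rfl

/-- **`ev A' = UX² · (1 + HS 2)`.** [folklore] -/
theorem ev_Apx : ev Apx = UX ^ 2 * (1 + HS 2) := by
  have := congrArg evHom Apx_eq
  rw [map_mul, map_pow, map_add, map_one] at this
  unfold UX
  rw [HS_eq_ev]
  exact this

/-- The closed form evenized, in the size-variable series. [folklore] -/
theorem ev_closedFormX : ev closedFormX = 5 * (UX ^ 2 * (1 + HS 2)) ^ 3 + UX ^ 3 * (UX ^ 2 * (1 + HS 2)) * (9 * HS 3 - 7) + UX ^ 4 * (3 * HS 4 + 2) := by
  have := congrArg evHom closedFormX_eq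
  rw [evHom_apply] at this
  rw [this]
  simp only [map_add, map_sub, map_mul, map_pow, map_ofNat, evHom_apply, ← HS_eq_ev, ev_Apx]
  rfl

/-- **The closed form read in the size variable**: `coeff (2m) (ev closedFormX) = oneDefectGF m`. [folklore] -/
theorem coeff_ev_closedFormX (m : ℕ) : coeff (2 * m) (ev closedFormX) = oneDefectGF m := by
  rw [coeff_ev_two_mul, oneDefectGF_eq_coeff]

end Summit.CriticalPhenomena.PercolationContinuityZ3.Theorems.Pcint.ChordDiag
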